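import Literature.MathematicalPhysics.QuantumFieldTheory.Balaban1983to89.B9CoReadingCoordsHolderSNear
import Literature.MathematicalPhysics.QuantumFieldTheory.Balaban1983to89.B9CoReadingCoordsInputS

/-!
# `Balaban1983to89.B9CoReadingCoordsHolderSNearReadings` — THE SITE INPUT CO-READINGS (3.44)–(3.45) OF THE N06 CERTIFICATE AT THE NEAR-PAIR SITE PIN CARRIER `holderProbesSN`:
# the twin of n06-d's `B9CoReadingCoordsInputS` ∕ n06-w6's `B9CoReadingCoordsHolderSAdmReadings` (routed through the site product rule), so that an edition re-pinning
# `h𝔭 : 𝔭 x = holderProbesSN …` keeps BOTH its site probe co-readings (`hH1` — prequel — and `hIR`) as one-line `have`s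

T. Bałaban, *Propagators for lattice gauge theories in a background field*, Commun. Math. Phys. **99** (1985) 389–434
[`Balaban1985BackgroundPropagators`, "B9"]; [4] = T. Bałaban, *Propagators and renormalization transformations for lattice gauge theories. II*, Commun. Math.
Phys. **96** (1984) 223–250 [`Balaban1984PropagatorsII`].

statement-level skeleton of published theorems with citation tags; proofs where landed; nothing here is a claim about the Yang–Mills mass gap

THE PRINT.  (3.40) p. 397 («sup_{x,x′:|x−x′|≦1}» at the scale ξ = L^{−j}: pairs with |x − x′| ≦ Lʲη, across block boundaries); (3.44)–(3.45) p. 398; [4] (2.67) p. 234, (2.137) p. 247.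

WHY THIS FILE (seat `pub-ymgap-dag-n06-c` g19; sequel of `B9CoReadingCoordsHolderSNear`, road R1∕R2 of the G′ Hölder layer of rows 20–21 — dag-n06-d `DISPLAY-LEDGER-UF.md` §2,
dag-n06-l g22 LOCATED (i)).  The certificate of record instantiates two co-reading families at the site pin `𝔭`: `site_inputReadsFam_of_pins(SA)` (`hIR`) and
`site_h1ReadsNbr_of_pins(SA)` (`hH1`, twin in the prequel); the input co-reading reaches the probes only through the site product rule, so its twin at the near carrier is
n06-d's proof with `hqS_le_of_probesSN`.
* ★★ `inputReadsFam_kernelFamilyS_coordsSN`, ★ `site_inputReadsFam_of_pinsSN`.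

HONEST SCOPE.  Verbatim re-proof of a landed co-reading theorem at a sibling pin carrier; nothing of [B9] or [4] asserted; no edition written; COUNT-NEUTRAL; N06 NOT discharged; one
finite 𝕋^{d+1} programme at fixed ε — nothing continuum, nothing about the mass gap.  Cell `pub-ymgap` (HUMAN RULING D-0062), Track A node N06 [B9], seat `pub-ymgap-dag-n06-c` (g19),
2026-08-29; a NEW file; 0 `def`, no `sorry`, no `axiom`, no `instance`, no `notation`.
-/

noncomputable section

namespace Literature.MathematicalPhysics.QuantumFieldTheory.Balaban1983to89.B9CoReadingCoordsHolderSNearReadings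

open B6GlobalChartV1 (PV domT blkV1)
open B6Geom246MultiLevelTorus (geomT triangle_refl_nonneg_T)
open B6Ineq2142KLevelV1 (β lvl)
open B6KLevelCensusIndexV1 (KIdx kGeo)
open B6Prop22KLevelTorusCensus (KTIdx)
open B6Prop22KLevelTorusCensusEta (nKT nKT_pos hqTP hqTP_nonneg pair_le_hqTP geoTP)
open B9GeoNormsKLevelV1 (geo9K geo9K_supNorm_nonneg geo9K_cutH_nonneg geo9K_holder_nonneg)
open B9Thm34Ext (toB6)
open B11SectG (BlockNorm)
open B9CoRealizesRelAtLetters (RelB)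
open B9RWSums343Holder (HolderProbes)
open B9RWSums344InputFam (InputReadsFam sliceProbe)
open B9RWSums346SecondDiff (familyOp)
open B9Ineq349SiteComposite (cdSL cdsSL etaS_pos)
open B9Thm39ReadingCoords (cR39 cR39_nonneg)
open B9CoReadingCoords (assembleK assembleK_smul evDiagK assembleK_evDiagK coordOpK coordOpK_apply coordOpK_comp assembleK_coordOpK coordOpK_evDiagK)
open B9CoReadingCoordsS (XSK evSK blkSK sIK sIK_faithful blkV1_site GcoS off_bound_evSK)
open B9CoReadingCoordsL2S (sIK_dist_le_one pairS3_eq)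
open B9CoReadingCoordsHolder (PK blkPK probeK wnorm_le_of_coords)
open B9CoReadingCoordsHolderSNear (wSN holderProbesSN hqS_le_of_probesSN)
open B9CoReadingCoordsInputS (bHS supS holS coordOpK_smul_family supS_evDiagK_le holS_evDiagK_le)
open Node00 (SiteY FBondY IBondY CfgY BallY liftY supBlkS' hqS etaS toKT kernelFamilyS SiteOpY SiteParY cdS cdsS iSup_ball_le)

variable {d ℓ : ℕ} {hd : 1 ≤ d + 1} {hL : Odd (ℓ + 1) ∧ 1 < ℓ + 1} {b₀ b₁ : ℝ}
variable {κ : Type} [Fintype κ] [DecidableEq κ]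

section Input

variable {𝔸 : Type} [NormedRing 𝔸] [NormedAlgebra ℂ 𝔸] [CompleteSpace 𝔸] [FiniteDimensional ℝ 𝔸]
variable (i : KIdx d ℓ hd hL b₀ b₁) [Fintype (geo9K i).Site] [DecidableRel (RelB i)] (b : Module.Basis κ ℝ 𝔸)
variable (B : B9.Backgrounds) (cfg : B.Cfg → CfgY 𝔸 i) (O : SiteOpY 𝔸 i) (par : SiteParY 𝔸 i) (U₁ : B.Cfg)
variable {bI : FBondY i → IBondY i}

/-- ★★ **THE SITE INPUT CO-READINGS (3.44)∕(3.45) OF `kernelFamilyS` ON THE PAIR-FAMILY COORDINATE MODEL WITH THE INPUT NORM `bHS`, PROBES OF THE NEAR SITE CARRIER** — n06-d's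
`inputReadsFam_kernelFamilyS_coords` ∕ n06-w6's `inputReadsFam_kernelFamilyS_coordsSA` with `holderProbesSN` (fields `isLoc ∕ loc_le ∕ hs_nonneg ∕ cutH_nonneg ∕ obs4` probe-free and verbatim; `obs5` through `hqS_le_of_probesSN`).
[cite: Balaban1985BackgroundPropagators, (3.44)–(3.45) p.398 + (3.39)–(3.42) p.397; Balaban1984PropagatorsII, (2.67) p.234, (2.51)–(2.52) p.232] -/
theorem inputReadsFam_kernelFamilyS_coordsSN
    (hβI : ∀ (x : FBondY i) (c : IBondY i), blkV1 i.hN i.D x = β i.hN i.D i.hk c → β i.hN i.D i.hk (bI x) = blkV1 i.hN i.D x)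
    (hβ1 : ∀ x : FBondY i, (geomT i.D).dist (β i.hN i.D i.hk (bI x)) (blkV1 i.hN i.D x) ≤ 1) {r : ℝ} (hr : 1 ≤ r) {R : ℝ} {H : Prop}
    {Dd Dds : Fin (d + 1) → ((XSK κ i → ℝ) →ₗ[ℝ] (XSK κ i → ℝ))}
    (hDd : Dd = fun μ => (etaS i)⁻¹ • coordOpK b (fun _ : Fin (d + 1) => (cdSL i (cfg U₁) μ).restrictScalars ℝ))
    (hDds : Dds = fun μ => (etaS i)⁻¹ • coordOpK b (fun _ : Fin (d + 1) => (cdsSL i (cfg U₁) μ).restrictScalars ℝ)) :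
    InputReadsFam (R := R) (H := H) (kernelFamilyS i B cfg O par) U₁ (fun ε => bHS i (sIK i bI) ε) r (blkSK i (sIK i bI) ∘ Prod.fst)
      (blkPK (sIK i bI) ∘ Prod.fst) (fun β => sliceProbe ((holderProbesSN i b B cfg par bI).ΦX U₁ β)) (evSK i)
      (familyOp fun q : Fin (d + 1) × Fin (d + 1) => Dd q.1 ∘ₗ (GcoS i b B cfg O U₁ ∘ₗ Dds q.2)) := by
  subst hDd hDds
  set T : Fin (d + 1) → Fin (d + 1) → (SiteY i → 𝔸) →ₗ[ℝ] (SiteY i → 𝔸) :=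
    fun μ ν => (cdSL i (cfg U₁) μ).restrictScalars ℝ ∘ₗ ((O (cfg U₁)).restrictScalars ℝ ∘ₗ (cdsSL i (cfg U₁) ν).restrictScalars ℝ) with hT
  have hmem : ∀ (μ ν : Fin (d + 1)) (F : XSK κ i → ℝ) (v : XSK κ i),
      (familyOp (fun q : Fin (d + 1) × Fin (d + 1) =>
        ((etaS i)⁻¹ • coordOpK b (fun _ : Fin (d + 1) => (cdSL i (cfg U₁) q.1).restrictScalars ℝ)) ∘ₗ (GcoS i b B cfg O U₁ ∘ₗ
          ((etaS i)⁻¹ • coordOpK b (fun _ : Fin (d + 1) => (cdsSL i (cfg U₁) q.2).restrictScalars ℝ)))) F) (v, (μ, ν)) =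
        (cR39 b • coordOpK b (fun _ : Fin (d + 1) => T μ ν)) F v := by
    intro μ ν F v
    show (((etaS i)⁻¹ • coordOpK b (fun _ : Fin (d + 1) => (cdSL i (cfg U₁) μ).restrictScalars ℝ)) ∘ₗ (GcoS i b B cfg O U₁ ∘ₗ
      ((etaS i)⁻¹ • coordOpK b (fun _ : Fin (d + 1) => (cdsSL i (cfg U₁) ν).restrictScalars ℝ)))) F v = _
    rw [pairS3_eq]
  have hE' : ∀ E : BallY 𝔸, ‖(E : 𝔸)‖ ≤ 1 := fun E => mem_closedBall_zero_iff.1 E.2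
  have hη : 0 < etaS i := etaS_pos i
  refine ⟨?_, ?_, ?_, ?_, ?_, ?_⟩
  · intro ε lam y' hs
    exact (off_bound_evSK (κ := κ) i (sIK_faithful i hβI)).1 lam y' hs
  · intro ε lam y' hs
    show supS i (sIK i bI) y' (evSK i lam) + holS i (sIK i bI) ε y' (evSK i lam) ≤ (geo9K i).holder ε lam + (geo9K i).supNorm lam
    cases lam with
    | inr J =>
        have h0 : evSK (κ := κ) i (Sum.inr J) = 0 := rfl
        have hl : supS i (sIK i bI) y' (evSK (κ := κ) i (Sum.inr J)) + holS i (sIK i bI) ε y' (evSK (κ := κ) i (Sum.inr J)) = 0 := by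
          rw [h0]; exact (bHS (R := R) (H := H) i (sIK i bI) ε).loc_zero y'
        rw [hl]; exact add_nonneg (geo9K_holder_nonneg i ε _) (geo9K_supNorm_nonneg i _)
    | inl f =>
        rw [add_comm]
        exact add_le_add (holS_evDiagK_le i (sIK_faithful i hβI) ε y' f hs) (supS_evDiagK_le i y' f)
  · intro ε lam
    exact add_nonneg (geo9K_holder_nonneg i ε lam) (geo9K_supNorm_nonneg i lam)
  · intro β' ζ
    exact geo9K_cutH_nonneg i β' ζ
  · intro lam y c hc hw
    cases lam with
    | inr J => exact hc
    | inl f =>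
        show (⨆ E : BallY 𝔸, ⨆ μ : Fin (d + 1),
            supBlkS' i (β i.hN i.D i.hk y) (fun ν => cdS i (cfg U₁) μ (O (cfg U₁) (cdsS i (cfg U₁) ν (liftY f (E : 𝔸)))))) ≤ c
        refine iSup_ball_le (fun E => Real.iSup_le (fun μ => ?_) hc) hc
        unfold supBlkS'
        refine Real.iSup_le (fun p => ?_) hc
        split_ifs with hp
        · have hnear : (geomT i.D).dist (β i.hN i.D i.hk (sIK i bI p.1)) (β i.hN i.D i.hk y) ≤ r := by
            have h1 := sIK_dist_le_one i hβ1 p.1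
            rw [hp] at h1
            linarith
          have key := wnorm_le_of_coords b (T μ p.2) f p.1 zero_le_one hc (fun cc cc' => ?_) (hE' E)
          · rw [one_mul] at key
            exact key
          have h2 := hw ((p.1, μ, cc, cc'), (μ, p.2)) hnear
          have hev : evSK (κ := κ) i (Sum.inl f) = evDiagK f := rfl
          rw [hmem, hev] at h2
          simp only [LinearMap.smul_apply, Pi.smul_apply, coordOpK_evDiagK, smul_eq_mul] at h2
          rw [one_mul]; exact h2
        · exact hc
  · intro lam β' ζ y c hc hcut hP
    have h0 : 0 ≤ c * (geo9K i).cutH β' ζ := mul_nonneg hc (geo9K_cutH_nonneg i β' ζ)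
    cases lam with
    | inr J => cases ζ with
      | inl zz => exact h0
      | inr zz => exact h0
    | inl f => cases ζ with
      | inr zz => exact h0
      | inl zz =>
          show (⨆ E : BallY 𝔸, ⨆ μ : Fin (d + 1), ⨆ ν : Fin (d + 1),
              hqS i (par (cfg U₁)) β' (fun w => ((zz w : ℝ) : ℂ) • cdS i (cfg U₁) μ (O (cfg U₁) (cdsS i (cfg U₁) ν (liftY f (E : 𝔸)))) w)) ≤
            c * (geoTP (toKT i)).cutH β' zz
          refine iSup_ball_le (fun E => Real.iSup_le (fun μ => Real.iSup_le (fun ν => ?_) h0) h0) h0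
          have key := hqS_le_of_probesSN i b (sIK_dist_le_one i hβ1) hr (par (cfg U₁)) (fun _ : Fin (d + 1) => (etaS i)⁻¹ • T μ ν) f β' zz y hc hcut
            (fun p hp => by
              have h2 := hP (p, (μ, ν)) hp
              have hsl : (fun v => (familyOp (fun q : Fin (d + 1) × Fin (d + 1) =>
                  ((etaS i)⁻¹ • coordOpK b (fun _ : Fin (d + 1) => (cdSL i (cfg U₁) q.1).restrictScalars ℝ)) ∘ₗ (GcoS i b B cfg O U₁ ∘ₗ
                    ((etaS i)⁻¹ • coordOpK b (fun _ : Fin (d + 1) => (cdsSL i (cfg U₁) q.2).restrictScalars ℝ)))) (evSK i (Sum.inl f))) (v, (μ, ν))) =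
                  ((etaS i * cR39 b) • coordOpK b (fun _ : Fin (d + 1) => (etaS i)⁻¹ • T μ ν)) (evDiagK f) := by
                funext v
                have hev : evSK (κ := κ) i (Sum.inl f) = evDiagK f := rfl
                rw [hmem, hev, coordOpK_smul_family, smul_smul, mul_right_comm, mul_inv_cancel₀ hη.ne', one_mul]
              rw [← hsl]
              exact h2) E μ
          have hfun : (fun w => ((zz w * etaS i : ℝ) : ℂ) • ((etaS i)⁻¹ • T μ ν) (liftY f (E : 𝔸)) w) =
              fun w => ((zz w : ℝ) : ℂ) • cdS i (cfg U₁) μ (O (cfg U₁) (cdsS i (cfg U₁) ν (liftY f (E : 𝔸)))) w := by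
            funext w
            rw [LinearMap.smul_apply, Pi.smul_apply, ← Complex.coe_smul, smul_smul, Complex.ofReal_mul, mul_assoc, ← Complex.ofReal_mul,
              mul_inv_cancel₀ hη.ne', Complex.ofReal_one, mul_one]
            rfl
          rw [hfun] at key
          exact key

/-- ★ **THE SITE INPUT CO-READINGS AT THE NEAR CARRIER UNDER THE PINS, RADIUS 2** (`𝔭 = holderProbesSN …`, `bH = bHS … (sIK bI)`, `blk = blkSK (sIK bI)`, `Gp = GcoS …`, `Dd ∕ Dds` pinned) — the twin
of n06-d's `site_inputReadsFam_of_pins` ∕ n06-w6's `site_inputReadsFam_of_pinsSA` (the certificate's `hIR`, row 18) that an edition re-pinned to the near carrier consumes verbatim. [cite: Balaban1985BackgroundPropagators, (3.44)–(3.45) p.398; Balaban1984PropagatorsII, (2.67) p.234] -/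
theorem site_inputReadsFam_of_pinsSN
    (hβI : ∀ (x : FBondY i) (c : IBondY i), blkV1 i.hN i.D x = β i.hN i.D i.hk c → β i.hN i.D i.hk (bI x) = blkV1 i.hN i.D x)
    (hβ1 : ∀ x : FBondY i, (geomT i.D).dist (β i.hN i.D i.hk (bI x)) (blkV1 i.hN i.D x) ≤ 1) {R : ℝ} {H : Prop}
    {𝔭 : HolderProbes (geo9K i) B (XSK κ i) (XSK κ i) (PK (SiteY i) (Fin (d + 1)) κ) (PK (SiteY i) (Fin (d + 1)) κ)}
    {bH : ℝ → BlockNorm (toB6 (geo9K i) R H) (XSK κ i → ℝ)} {blk : XSK κ i → IBondY i} {G : (XSK κ i → ℝ) →ₗ[ℝ] (XSK κ i → ℝ)}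
    {Dd Dds : Fin (d + 1) → ((XSK κ i → ℝ) →ₗ[ℝ] (XSK κ i → ℝ))}
    (h𝔭 : 𝔭 = holderProbesSN i b B cfg par bI) (hbH : bH = fun ε => bHS i (sIK i bI) ε) (hblk : blk = blkSK i (sIK i bI)) (hG : G = GcoS i b B cfg O U₁)
    (hDd : Dd = fun μ => (etaS i)⁻¹ • coordOpK b (fun _ : Fin (d + 1) => (cdSL i (cfg U₁) μ).restrictScalars ℝ))
    (hDds : Dds = fun μ => (etaS i)⁻¹ • coordOpK b (fun _ : Fin (d + 1) => (cdsSL i (cfg U₁) μ).restrictScalars ℝ)) :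
    InputReadsFam (R := R) (H := H) (kernelFamilyS i B cfg O par) U₁ bH 2 (blk ∘ Prod.fst) (𝔭.blkPX ∘ Prod.fst) (fun β => sliceProbe (𝔭.ΦX U₁ β)) (evSK i)
      (familyOp fun q : Fin (d + 1) × Fin (d + 1) => Dd q.1 ∘ₗ (G ∘ₗ Dds q.2)) := by
  subst h𝔭 hbH hblk hG
  exact inputReadsFam_kernelFamilyS_coordsSN i b B cfg O par U₁ hβI hβ1 (by norm_num) hDd hDds

end Input

end Literature.MathematicalPhysics.QuantumFieldTheory.Balaban1983to89.B9CoReadingCoordsHolderSNearReadings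

end
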